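import Summits.QuantumFields.YangMills.Theorems.IR.Negative.TypOnsetFloorPoly.RouteB

/-!
# Crux `IR` (stmt-QuantumFields-19354) — the POLYNOMIAL ROW FLOOR `b⋆_T(β) ≥ c·(β / log β)^{1/7}` for EVERY compact gauge group,
# part 5/10: §4e Markov and the regime arithmetic, §4f continuity of the twist defect, §4g Stokes under the kernel (sections `Markov`, `K0`, `PlaqDefect`)

Re-homed VERBATIM (statements, proofs, names; namespace `…Cruxes.IR.CruxIdea2g7` ↦ `…Cruxes.IR.RowFloorPoly`) from the crux
workfile `Cruxes/IR/CruxIdea2RowFloorPoly.lean` rev 14 (sha16 742d7312ea0b5c70; author `ym-cruxidea-19354-2` GEN 7; kernel certificate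
`Cruxes/IR/CruxIdea2RowFloorPolyCert.lean` rev 1, sha16 59d3cfe64fab9c7c, gate-elaborated stub-free) per owner R114 (2) (landing seat:
the `ym-19354-disprove-1` lineage, g9), split by its sections into ten ≤ 400-line modules chained by import; the module docstring of
record (history, theorem map, honest framing) is in the headline module `Theorems/IR/Negative/TypOnsetFloorPoly.lean` (part 10/10).
Negative knowledge for stmt-QuantumFields-19354 (`--supports`; closes no stub); not mixing, not a mass gap, nothing about Clay.
-/

set_option autoImplicit false

noncomputable section

open MeasureTheory Filter Topology
open Literature.MathematicalPhysics.QuantumLattice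
open Literature.Probability.LatticeModels
open Summit.QuantumFields.YangMills.Cruxes.IR.Tempered (cellEdges windowCells regionEdges)
open Summit.QuantumFields.YangMills.Cruxes.IR.ShellTempered (windowCellsPlus)
open Summit.QuantumFields.YangMills.Cruxes.IR.OnsetFormats (TypShellCond shellCount)
open Summit.QuantumFields.YangMills.Cruxes.IR.FixedMesh
open Summit.QuantumFields.YangMills.Cruxes.IR.FixedMeshAllG
open Summit.QuantumFields.YangMills.Theorems.FemtoCurvatureTwoPoint.DoublingOfRV (norm_rho_mul_sub_one_le norm_rho_inv_sub_one)
open Summit.QuantumFields.YangMills.Cruxes.IR.HairpinStokes (norm_map_conj_sub_one sub_re_trace_eq_norm_sq)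
open Literature.MathematicalPhysics.QuantumFieldTheory (abs_re_trace_le_sqrt_mul re_trace_map_inv)

namespace Summit.QuantumFields.YangMills.Cruxes.IR.RowFloorPoly

/-! ## §4e (PROVED) K_poly from an in-mean bound + measurability (Markov and the regime arithmetic) -/

section Markov

open scoped Matrix Matrix.Norms.Frobenius
open Literature.MathematicalPhysics.QuantumFieldTheory (wilsonMeasure GaugeConfig isProbabilityMeasure_wilsonMeasure)
open Summit.QuantumFields.YangMills.Theorems.TunedSequenceExists.Negative.Freezing (re_trace_le_of_mem_unitaryGroup)

variable {G : Type} [Group G] [TopologicalSpace G] [IsTopologicalGroup G] [CompactSpace G]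
  [SecondCountableTopology G] [MeasurableSpace G] [BorelSpace G]
  {N : ℕ} (ρ : G →* Matrix (Fin N) (Fin N) ℂ)

omit [TopologicalSpace G] [IsTopologicalGroup G] [CompactSpace G] [SecondCountableTopology G] [MeasurableSpace G]
  [BorelSpace G] in
/-- `‖ρ g − 1‖_F ≤ 2√N` for unitary `ρ`. -/
theorem norm_map_sub_one_le (hρu : ∀ g, ρ g ∈ Matrix.unitaryGroup (Fin N) ℂ) (g : G) :
    ‖ρ g - 1‖ ≤ 2 * Real.sqrt N := by
  have hneg : -(ρ g) ∈ Matrix.unitaryGroup (Fin N) ℂ := by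
    have h := SetLike.coe_mem (-(⟨ρ g, hρu g⟩ : Matrix.unitaryGroup (Fin N) ℂ))
    rw [Unitary.coe_neg] at h
    exact h
  have h2 : -(ρ g).trace.re ≤ N := by
    have := re_trace_le_of_mem_unitaryGroup hneg
    simpa [Matrix.trace_neg] using this
  have h1 := sub_re_trace_eq_norm_sq ρ hρu g
  have h3 : ‖ρ g - 1‖ ^ 2 ≤ (2 * Real.sqrt N) ^ 2 := by
    rw [mul_pow, Real.sq_sqrt (Nat.cast_nonneg _)]
    nlinarith
  calc ‖ρ g - 1‖ = Real.sqrt (‖ρ g - 1‖ ^ 2) := (Real.sqrt_sq (norm_nonneg _)).symm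
    _ ≤ Real.sqrt ((2 * Real.sqrt N) ^ 2) := Real.sqrt_le_sqrt h3
    _ = 2 * Real.sqrt N := Real.sqrt_sq (by positivity)

omit [SecondCountableTopology G] in
/-- Helper lemma `twistDefect_nonneg` of the row-floor chain (re-homed verbatim from the crux workfile; see the module docstring). -/
theorem twistDefect_nonneg (β : ℝ) (b n : ℕ) (k₀ : G) (V : GaugeConfig 4 (2 * ((2 * n + 2) * b + 1) + 1) G) :
    0 ≤ twistDefect ρ β b n k₀ V :=
  integral_nonneg fun _ => norm_nonneg _

/-- Helper lemma `twistDefect_le` of the row-floor chain (re-homed verbatim from the crux workfile; see the module docstring). -/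
theorem twistDefect_le (hρ : Continuous ρ) (hρu : ∀ g, ρ g ∈ Matrix.unitaryGroup (Fin N) ℂ) (β : ℝ) (b n : ℕ)
    (k₀ : G) (V : GaugeConfig 4 (2 * ((2 * n + 2) * b + 1) + 1) G) :
    twistDefect ρ β b n k₀ V ≤ 2 * Real.sqrt N := by
  unfold twistDefect
  haveI := isProbabilityMeasure_ymSpecification ρ hρ β (rowRegion b n)
    (twistΦ b (comb b ((2 * n + 2) * b + 1) k₀) (torusLift (2 * ((2 * n + 2) * b + 1) + 1) V))
  refine (integral_mono_of_nonneg (ae_of_all _ fun _ => norm_nonneg _) (integrable_const (2 * Real.sqrt N))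
    (ae_of_all _ fun U => norm_map_sub_one_le ρ hρu _)).trans ?_
  simp

/-- **K_poly from an in-mean bound (PROVED): Markov + the regime arithmetic.**  If `V ↦ twistDefect V` is measurable
and `E_{L_b,β} twistDefect ≤ C b^{7/2} √(log β / β)` for `β ≥ β₁`, `b ≥ 1`, then `KernelDefectPoly ρ n k₀ (1/7)` with
`c(η) = (η²/C)^{2/7}`, `β₀ = max β₁ 3`. -/
theorem kernelDefectPoly_of_mean (hρ : Continuous ρ) (hρu : ∀ g, ρ g ∈ Matrix.unitaryGroup (Fin N) ℂ) {n : ℕ}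
    {k₀ : G} (hmeas : ∀ (β : ℝ) (b : ℕ), Measurable (twistDefect ρ β b n k₀))
    (hmean : ∃ C : ℝ, 0 < C ∧ ∃ β₁ : ℝ, ∀ β : ℝ, β₁ ≤ β → ∀ b : ℕ, 1 ≤ b →
      ∫ V, twistDefect ρ β b n k₀ V ∂(wilsonMeasure (d := 4) (L := 2 * ((2 * n + 2) * b + 1) + 1) ρ β) ≤
        C * (b : ℝ) ^ (7 / 2 : ℝ) * Real.sqrt (Real.log β / β)) :
    KernelDefectPoly ρ n k₀ (1 / 7) := by
  intro η hη
  obtain ⟨C, hC, β₁, hmean⟩ := hmean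
  have hq0 : 0 ≤ η ^ 2 / C := div_nonneg (sq_nonneg _) hC.le
  refine ⟨(η ^ 2 / C) ^ (2 / 7 : ℝ), Real.rpow_pos_of_pos (div_pos (pow_pos hη 2) hC) _, max β₁ 3,
    fun β hβ b hb hbc => ?_⟩
  set c : ℝ := (η ^ 2 / C) ^ (2 / 7 : ℝ) with hc
  set μ := wilsonMeasure (d := 4) (L := 2 * ((2 * n + 2) * b + 1) + 1) ρ β with hμ
  haveI : IsProbabilityMeasure μ := isProbabilityMeasure_wilsonMeasure ρ hρ β
  have hβ1 : β₁ ≤ β := (le_max_left _ _).trans hβ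
  have hβ3 : (3 : ℝ) ≤ β := (le_max_right _ _).trans hβ
  have hβ0 : (0 : ℝ) < β := by linarith
  have hlog : 0 < Real.log β := Real.log_pos (by linarith)
  have hX0 : 0 ≤ β / Real.log β := by positivity
  have hc0 : 0 ≤ c := Real.rpow_nonneg hq0 _
  -- the regime arithmetic: `C b^{7/2} √(log β/β) ≤ η²`
  have h1 : (b : ℝ) ^ (7 / 2 : ℝ) ≤ (c * (β / Real.log β) ^ (1 / 7 : ℝ)) ^ (7 / 2 : ℝ) :=
    Real.rpow_le_rpow (Nat.cast_nonneg _) hbc (by norm_num)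
  have h2 : (c * (β / Real.log β) ^ (1 / 7 : ℝ)) ^ (7 / 2 : ℝ) =
      c ^ (7 / 2 : ℝ) * Real.sqrt (β / Real.log β) := by
    rw [Real.mul_rpow hc0 (Real.rpow_nonneg hX0 _), ← Real.rpow_mul hX0, Real.sqrt_eq_rpow]
    norm_num
  have h3 : c ^ (7 / 2 : ℝ) = η ^ 2 / C := by
    rw [hc, ← Real.rpow_mul hq0]
    norm_num
  have h4 : Real.sqrt (β / Real.log β) * Real.sqrt (Real.log β / β) = 1 := by
    rw [← Real.sqrt_mul hX0, show β / Real.log β * (Real.log β / β) = 1 by field_simp, Real.sqrt_one]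
  have key : C * (b : ℝ) ^ (7 / 2 : ℝ) * Real.sqrt (Real.log β / β) ≤ η ^ 2 := by
    have hs0 : 0 ≤ Real.sqrt (Real.log β / β) := Real.sqrt_nonneg _
    calc C * (b : ℝ) ^ (7 / 2 : ℝ) * Real.sqrt (Real.log β / β)
        ≤ C * (c ^ (7 / 2 : ℝ) * Real.sqrt (β / Real.log β)) * Real.sqrt (Real.log β / β) := by
          rw [← h2]; gcongr
      _ = C * c ^ (7 / 2 : ℝ) * (Real.sqrt (β / Real.log β) * Real.sqrt (Real.log β / β)) := by ring
      _ = η ^ 2 := by rw [h4, h3, mul_one]; field_simp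
  -- Markov
  have hint : Integrable (twistDefect ρ β b n k₀) μ :=
    Integrable.of_bound (hmeas β b).aestronglyMeasurable (2 * Real.sqrt N) (ae_of_all _ fun V => by
      rw [Real.norm_eq_abs, abs_of_nonneg (twistDefect_nonneg ρ β b n k₀ V)]
      exact twistDefect_le ρ hρ hρu β b n k₀ V)
  have hmarkov := mul_meas_ge_le_integral_of_nonneg (ae_of_all _ fun V => twistDefect_nonneg ρ β b n k₀ V) hint η
  have hm := hmean β hβ1 b hb
  have hreal : μ.real {V | η < twistDefect ρ β b n k₀ V} ≤ η := by
    have hsub : {V | η < twistDefect ρ β b n k₀ V} ⊆ {V | η ≤ twistDefect ρ β b n k₀ V} := fun V hV => by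
      simp only [Set.mem_setOf_eq] at hV ⊢
      exact hV.le
    refine (measureReal_mono hsub).trans ?_
    have hle : η * μ.real {V | η ≤ twistDefect ρ β b n k₀ V} ≤ η ^ 2 := hmarkov.trans (hm.trans key)
    by_contra hcon
    push Not at hcon
    nlinarith [hη, hcon, hle]
  calc μ {V | η < twistDefect ρ β b n k₀ V} = ENNReal.ofReal (μ.real {V | η < twistDefect ρ β b n k₀ V}) :=
        (ofReal_measureReal (measure_ne_top μ _)).symm
    _ ≤ ENNReal.ofReal η := ENNReal.ofReal_le_ofReal hreal

end Markov

/-! ## §4f (PROVED) K0: the twist defect is continuous in the torus sample -/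

section K0

open scoped Matrix Matrix.Norms.Frobenius
open Literature.MathematicalPhysics.QuantumFieldTheory (wilsonMeasure GaugeConfig isProbabilityMeasure_wilsonMeasure)

variable {G : Type} [Group G] [TopologicalSpace G] [IsTopologicalGroup G] [CompactSpace G]
  [SecondCountableTopology G] [MeasurableSpace G] [BorelSpace G]
  {N : ℕ} (ρ : G →* Matrix (Fin N) (Fin N) ℂ)

/-- Under the kernel `γ_Λ(·|η)`, `Λ = rowRegion b n`, the staple of the boundary condition equals the staple of the
sample (the staple reads only links OFF the row, `FixedMesh.staple_eq_of_eq_off_row`). -/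
theorem integral_kernel_staple_boundary (hρ : Continuous ρ) (β : ℝ) {b n m : ℕ}
    (hm : (m : ℤ) = (2 * (n : ℤ) + 1) * b) (η : LGConfig 4 G) :
    ∫ U, ‖ρ (col b U * staple b m η) - 1‖ ∂(ymSpecification ρ β (rowRegion b n) η) =
      ∫ U, ‖ρ (col b U * staple b m U) - 1‖ ∂(ymSpecification ρ β (rowRegion b n) η) := by
  have hF1 : Continuous fun U : LGConfig 4 G => ‖ρ (col b U * staple b m η) - 1‖ :=
    ((hρ.comp ((continuous_col b).mul continuous_const)).sub continuous_const).norm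
  have hF2 : Continuous fun U : LGConfig 4 G => ‖ρ (col b U * staple b m U) - 1‖ :=
    ((hρ.comp ((continuous_col b).mul (continuous_staple b _))).sub continuous_const).norm
  rw [integral_ymSpecification ρ hρ β (rowRegion b n) hF1.measurable,
    integral_ymSpecification ρ hρ β (rowRegion b n) hF2.measurable]
  refine congrArg (· / _) (integral_congr_ae (ae_of_all _ fun ζ => ?_))
  have hst : staple b m (glueWith (rowRegion b n) ζ η) = staple b m η :=
    staple_eq_of_eq_off_row hm fun e he => glueWith_apply_not_mem (rowRegion b n) ζ η he
  simp only [hst]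

/-- `twistDefect` is the kernel mean of the FIXED continuous integrand `U ↦ ‖ρ(col U · staple U) − 1‖_F`. -/
theorem twistDefect_eq_integral_self (hρ : Continuous ρ) (β : ℝ) (b n : ℕ) (k₀ : G)
    (V : GaugeConfig 4 (2 * ((2 * n + 2) * b + 1) + 1) G) :
    twistDefect ρ β b n k₀ V =
      ∫ U, ‖ρ (col b U * staple b ((2 * n + 1) * b) U) - 1‖
        ∂(ymSpecification ρ β (rowRegion b n)
          (twistΦ b (comb b ((2 * n + 2) * b + 1) k₀) (torusLift (2 * ((2 * n + 2) * b + 1) + 1) V))) := by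
  have hm : (((2 * n + 1) * b : ℕ) : ℤ) = (2 * (n : ℤ) + 1) * b := by push_cast; ring
  exact integral_kernel_staple_boundary ρ hρ β hm _

/-- **K0 (PROVED): `V ↦ twistDefect V` is continuous**, as the composite of the continuous boundary map
`V ↦ topTwist(comb)(torusLift V)` (`FixedMeshAllG.continuous_twist_comb`, `continuous_torusLift`) with the kernel mean of a
fixed bounded continuous integrand (`continuous_integral_ymSpecification`), by `twistDefect_eq_integral_self`. -/
theorem continuous_twistDefect (hρ : Continuous ρ) (hρu : ∀ g, ρ g ∈ Matrix.unitaryGroup (Fin N) ℂ) (β : ℝ)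
    (b n : ℕ) (k₀ : G) : Continuous (twistDefect ρ β b n k₀) := by
  have hF2 : Continuous fun U : LGConfig 4 G => ‖ρ (col b U * staple b ((2 * n + 1) * b) U) - 1‖ :=
    ((hρ.comp ((continuous_col b).mul (continuous_staple b _))).sub continuous_const).norm
  have hker := continuous_integral_ymSpecification ρ hρ β (rowRegion b n) hF2 (C := 2 * Real.sqrt N)
    (fun U => by rw [abs_of_nonneg (norm_nonneg _)]; exact norm_map_sub_one_le ρ hρu _)
  have hbd : Continuous fun V : GaugeConfig 4 (2 * ((2 * n + 2) * b + 1) + 1) G =>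
      twistΦ b (comb b ((2 * n + 2) * b + 1) k₀) (torusLift (2 * ((2 * n + 2) * b + 1) + 1) V) :=
    (continuous_twist_comb b _ k₀).comp (continuous_torusLift _)
  have h := hker.comp hbd
  refine h.congr fun V => ?_
  simp only [Function.comp]
  exact (twistDefect_eq_integral_self ρ hρ β b n k₀ V).symm

/-- **K0 (PROVED): measurability of the twist defect.** -/
theorem measurable_twistDefect (hρ : Continuous ρ) (hρu : ∀ g, ρ g ∈ Matrix.unitaryGroup (Fin N) ℂ) (β : ℝ)
    (b n : ℕ) (k₀ : G) : Measurable (twistDefect ρ β b n k₀) :=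
  (continuous_twistDefect ρ hρ hρu β b n k₀).measurable

end K0

/-! ## §4g (PROVED) Stokes under the kernel: K1 reduces to the kernel mean of the film's PLAQUETTE defects -/

section PlaqDefect

open scoped Matrix Matrix.Norms.Frobenius
open Literature.MathematicalPhysics.QuantumFieldTheory (wilsonMeasure GaugeConfig isProbabilityMeasure_wilsonMeasure)
open Summit.QuantumFields.YangMills.Theorems.TunedSequenceExists.Negative.Freezing (integrable_of_continuous)

variable {G : Type} [Group G] [TopologicalSpace G] [IsTopologicalGroup G] [CompactSpace G]
  [SecondCountableTopology G] [MeasurableSpace G] [BorelSpace G]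
  {N : ℕ} (ρ : G →* Matrix (Fin N) (Fin N) ℂ)

/-- The total Frobenius plaquette defect `Σ_{p∈Σ} ‖ρ(U_p) − 1‖_F` of the spanning surface `Σ = [0,b] × [0,m)` of the
row loop (`#Σ = (b+1)·m`). -/
def plaqDefectSum (b m : ℕ) (U : LGConfig 4 G) : ℝ :=
  ∑ s ∈ Finset.range m, ∑ t ∈ Finset.range (b + 1), ‖ρ (plaq U t s) - 1‖

omit [CompactSpace G] [SecondCountableTopology G] [MeasurableSpace G] [BorelSpace G] in
/-- Helper lemma `continuous_plaq` of the row-floor chain (re-homed verbatim from the crux workfile; see the module docstring). -/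
theorem continuous_plaq (t s : ℤ) : Continuous fun U : LGConfig 4 G => plaq U t s := by
  unfold plaq plaquetteHolonomyZd
  have h : ∀ e : ZdEdge 4, Continuous fun U : LGConfig 4 G => U e := fun e => continuous_apply e
  exact (((h _).mul (h _)).mul (h _).inv).mul (h _).inv

omit [CompactSpace G] [SecondCountableTopology G] [MeasurableSpace G] [BorelSpace G] in
/-- Helper lemma `continuous_plaqDefectSum` of the row-floor chain (re-homed verbatim from the crux workfile; see the module docstring). -/
theorem continuous_plaqDefectSum (hρ : Continuous ρ) (b m : ℕ) : Continuous (plaqDefectSum ρ b m) := by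
  unfold plaqDefectSum
  exact continuous_finsetSum _ fun s _ => continuous_finsetSum _ fun t _ =>
    ((hρ.comp (continuous_plaq _ _)).sub continuous_const).norm

omit [TopologicalSpace G] [IsTopologicalGroup G] [CompactSpace G] [SecondCountableTopology G] [MeasurableSpace G]
  [BorelSpace G] in
/-- Helper lemma `plaqDefectSum_nonneg` of the row-floor chain (re-homed verbatim from the crux workfile; see the module docstring). -/
theorem plaqDefectSum_nonneg (b m : ℕ) (U : LGConfig 4 G) : 0 ≤ plaqDefectSum ρ b m U :=
  Finset.sum_nonneg fun _ _ => Finset.sum_nonneg fun _ _ => norm_nonneg _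

omit [TopologicalSpace G] [IsTopologicalGroup G] [CompactSpace G] [SecondCountableTopology G] [MeasurableSpace G]
  [BorelSpace G] in
/-- Helper lemma `plaqDefectSum_le` of the row-floor chain (re-homed verbatim from the crux workfile; see the module docstring). -/
theorem plaqDefectSum_le (hρu : ∀ g, ρ g ∈ Matrix.unitaryGroup (Fin N) ℂ) (b m : ℕ) (U : LGConfig 4 G) :
    plaqDefectSum ρ b m U ≤ m * ((b + 1) * (2 * Real.sqrt N)) := by
  unfold plaqDefectSum
  have h1 : ∀ s ∈ Finset.range m, ∑ t ∈ Finset.range (b + 1), ‖ρ (plaq U t s) - 1‖ ≤ (b + 1) * (2 * Real.sqrt N) := by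
    intro s _
    have h := Finset.sum_le_card_nsmul (Finset.range (b + 1)) (fun t => ‖ρ (plaq U (t : ℤ) s) - 1‖)
      (2 * Real.sqrt N) fun t _ => norm_map_sub_one_le ρ hρu _
    simpa [Finset.card_range, nsmul_eq_mul] using h
  have h2 := Finset.sum_le_card_nsmul (Finset.range m)
    (fun s => ∑ t ∈ Finset.range (b + 1), ‖ρ (plaq U t s) - 1‖) ((b + 1) * (2 * Real.sqrt N)) h1
  simpa [Finset.card_range, nsmul_eq_mul] using h2

omit [TopologicalSpace G] [IsTopologicalGroup G] [CompactSpace G] [SecondCountableTopology G] [MeasurableSpace G]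
  [BorelSpace G] in
/-- **Deterministic Stokes for the defect (PROVED):** `‖ρ(col U · staple U) − 1‖_F ≤ Σ_{p∈Σ} ‖ρ(U_p) − 1‖_F`. -/
theorem norm_col_mul_staple_sub_one_le (hρu : ∀ g, ρ g ∈ Matrix.unitaryGroup (Fin N) ℂ) {b : ℕ} (hb : 1 ≤ b)
    (m : ℕ) (U : LGConfig 4 G) : ‖ρ (col b U * staple b m U) - 1‖ ≤ plaqDefectSum ρ b m U := by
  have hconj : ‖ρ (col b U * staple b m U) - 1‖ = ‖ρ (rectHol U (b + 1) m) - 1‖ := by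
    rw [col_mul_staple_eq_conj_rectHol hb m U]
    have := norm_map_conj_sub_one ρ hρu (U (site2 0 0, 0))⁻¹ (rectHol U (b + 1) m)
    rwa [inv_inv] at this
  rw [hconj]
  exact norm_rectHol_sub_one_le ρ hρu U (b + 1) m

/-- The kernel mean of the film's plaquette defect with the twisted boundary: `E_{γ_Λ(·|σ')} Σ_{p∈Σ} ‖ρ(U_p) − 1‖_F`,
`σ' = topTwist(comb)(torusLift V)`. -/
def kernelPlaqDefect (β : ℝ) (b n : ℕ) (k₀ : G) (V : GaugeConfig 4 (2 * ((2 * n + 2) * b + 1) + 1) G) : ℝ :=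
  ∫ U, plaqDefectSum ρ b ((2 * n + 1) * b) U
    ∂(ymSpecification ρ β (rowRegion b n)
      (twistΦ b (comb b ((2 * n + 2) * b + 1) k₀) (torusLift (2 * ((2 * n + 2) * b + 1) + 1) V)))

omit [SecondCountableTopology G] in
/-- Helper lemma `kernelPlaqDefect_nonneg` of the row-floor chain (re-homed verbatim from the crux workfile; see the module docstring). -/
theorem kernelPlaqDefect_nonneg (β : ℝ) (b n : ℕ) (k₀ : G) (V : GaugeConfig 4 (2 * ((2 * n + 2) * b + 1) + 1) G) :
    0 ≤ kernelPlaqDefect ρ β b n k₀ V :=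
  integral_nonneg fun U => plaqDefectSum_nonneg ρ _ _ U

/-- **K1 ⇐ K1′ pointwise (PROVED): `twistDefect ≤ kernelPlaqDefect`** (Stokes under the kernel). -/
theorem twistDefect_le_kernelPlaqDefect (hρ : Continuous ρ) (hρu : ∀ g, ρ g ∈ Matrix.unitaryGroup (Fin N) ℂ)
    (β : ℝ) {b : ℕ} (hb : 1 ≤ b) (n : ℕ) (k₀ : G) (V : GaugeConfig 4 (2 * ((2 * n + 2) * b + 1) + 1) G) :
    twistDefect ρ β b n k₀ V ≤ kernelPlaqDefect ρ β b n k₀ V := by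
  rw [twistDefect_eq_integral_self ρ hρ β b n k₀ V]
  unfold kernelPlaqDefect
  set γ := ymSpecification ρ β (rowRegion b n)
    (twistΦ b (comb b ((2 * n + 2) * b + 1) k₀) (torusLift (2 * ((2 * n + 2) * b + 1) + 1) V)) with hγ
  haveI : IsProbabilityMeasure γ := isProbabilityMeasure_ymSpecification ρ hρ β _ _
  have hF2 : Continuous fun U : LGConfig 4 G => ‖ρ (col b U * staple b ((2 * n + 1) * b) U) - 1‖ :=
    ((hρ.comp ((continuous_col b).mul (continuous_staple b _))).sub continuous_const).norm
  exact integral_mono (integrable_of_continuous γ hF2) (integrable_of_continuous γ (continuous_plaqDefectSum ρ hρ _ _))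
    fun U => norm_col_mul_staple_sub_one_le ρ hρu hb _ U

/-- `V ↦ kernelPlaqDefect V` is continuous (same argument as `continuous_twistDefect`). -/
theorem continuous_kernelPlaqDefect (hρ : Continuous ρ) (hρu : ∀ g, ρ g ∈ Matrix.unitaryGroup (Fin N) ℂ) (β : ℝ)
    (b n : ℕ) (k₀ : G) : Continuous (kernelPlaqDefect ρ β b n k₀) := by
  have hker := continuous_integral_ymSpecification ρ hρ β (rowRegion b n)
    (continuous_plaqDefectSum ρ hρ b ((2 * n + 1) * b))
    (C := ((2 * n + 1) * b : ℕ) * ((b + 1) * (2 * Real.sqrt N)))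
    (fun U => by rw [abs_of_nonneg (plaqDefectSum_nonneg ρ _ _ U)]; exact plaqDefectSum_le ρ hρu _ _ U)
  have hbd : Continuous fun V : GaugeConfig 4 (2 * ((2 * n + 2) * b + 1) + 1) G =>
      twistΦ b (comb b ((2 * n + 2) * b + 1) k₀) (torusLift (2 * ((2 * n + 2) * b + 1) + 1) V) :=
    (continuous_twist_comb b _ k₀).comp (continuous_torusLift _)
  exact hker.comp hbd

/-- **K1 ⇐ K1′ in mean (PROVED).** -/
theorem integral_twistDefect_le_of_kernelPlaqDefect (hρ : Continuous ρ)
    (hρu : ∀ g, ρ g ∈ Matrix.unitaryGroup (Fin N) ℂ) {n : ℕ} {k₀ : G}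
    (h : ∃ C : ℝ, 0 < C ∧ ∃ β₁ : ℝ, ∀ β : ℝ, β₁ ≤ β → ∀ b : ℕ, 1 ≤ b →
      ∫ V, kernelPlaqDefect ρ β b n k₀ V ∂(wilsonMeasure (d := 4) (L := 2 * ((2 * n + 2) * b + 1) + 1) ρ β) ≤
        C * (b : ℝ) ^ (7 / 2 : ℝ) * Real.sqrt (Real.log β / β)) :
    ∃ C : ℝ, 0 < C ∧ ∃ β₁ : ℝ, ∀ β : ℝ, β₁ ≤ β → ∀ b : ℕ, 1 ≤ b →
      ∫ V, twistDefect ρ β b n k₀ V ∂(wilsonMeasure (d := 4) (L := 2 * ((2 * n + 2) * b + 1) + 1) ρ β) ≤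
        C * (b : ℝ) ^ (7 / 2 : ℝ) * Real.sqrt (Real.log β / β) := by
  obtain ⟨C, hC, β₁, h⟩ := h
  refine ⟨C, hC, β₁, fun β hβ b hb => ?_⟩
  set μ := wilsonMeasure (d := 4) (L := 2 * ((2 * n + 2) * b + 1) + 1) ρ β with hμ
  haveI : IsProbabilityMeasure μ := isProbabilityMeasure_wilsonMeasure ρ hρ β
  refine (integral_mono (integrable_of_continuous μ (continuous_twistDefect ρ hρ hρu β b n k₀))
    (integrable_of_continuous μ (continuous_kernelPlaqDefect ρ hρ hρu β b n k₀))
    fun V => twistDefect_le_kernelPlaqDefect ρ hρ hρu β hb n k₀ V).trans (h β hβ b hb)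

end PlaqDefect

end Summit.QuantumFields.YangMills.Cruxes.IR.RowFloorPoly

end
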